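import Summits.QuantumFields.BalabanUV.Beta.GAN24.WilsonVertexSumZero
import Literature.MathematicalPhysics.QuantumFieldTheory.Balaban1983to89.Beta.BalabanStepW2
import Summits.QuantumFields.BalabanUV.Beta.HessKerDressedUnits

/-!
# `BalabanUV.Beta.GAN24.WilsonVertexTwoConst` — (S3c)₀ of `SKELETON-W3.md` v0.2 §7.2 (row owner gan24-p1-g5, RULINGS-13 (R13-2) «W3-S3C0*»):
# THE STRIPPED CUBIC WILSON TABLE `wilsonA` CONTRACTED WITH ANY TWO CONSTANT FIELD LEGS VANISHES

NOT IN PRINT; OUR BOOKKEEPING (row G-an2-4 ∕ (CONV-C), W-slot located remainder, road «W3», row family (F2) zero modes, sum rule (S3c) at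
level `m = 0`).  an3's field–field table of the one-bond cubic Wilson vertex, `StepJetData.wilsonA d κ′ u w y (inl α) (inl β)` (table bond
`(κ′, u)`, fluctuation legs `(w, α)`, `(y, β)`), has THREE site slots `u, w, y`.  Leaf W1 (`WilsonVertexSumZero.wilsonA_tsum_zero`, leaf-15) sums
the two KERNEL legs `w, y` at fixed table bond.  THIS file sums the TABLE SITE `u` together with ONE kernel leg, the other leg free:
* §1 support in the table site: for a fixed leg site `y` only the `3^{d+1}` table sites `u ∈ y − {−1,0,1}^{d+1}` contribute;
* §2 the finite double sums `Σ_u Σ_w` (leg `y` free) and `Σ_u Σ_y` (leg `w` free) of the raw table `wEntry` and of `wilsonA` VANISH over every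
  finite superset of the support — by TRANSLATION COVARIANCE of the stencil (entry = indicator sum over the stencil index with
  site-independent blocks, `WilsonVertexSumZero.wEntry_eq_sum`): each of the three double sums collapses onto the same block sum
  `Σ_i wc κ′ i α β = 0` (`WilsonVertexSumZero.sum_wc_eq_zero`).  No leg-permutation symmetry of the model table is used or claimed;
* §3 support-free currencies: `∑' u, ∑' w`, `∑' w, ∑' u`, `∑' u, ∑' y`, `∑' y, ∑' u` forms and `HasSum` on the pair type;
* §4 the same three contractions for the ff-block of an2's first field table `BalabanStepW2.Spure … 0 = cE • wilsonA + cVH • mfNeg ∘ vhS` (the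
  border is OFF the ff-block: `packVH_inl_inl`) and of its normalised form `HessKerDressedUnits.unitS s_f s_m (Spure … 0)` (the census object
  `S̃₀` of §7.2; the ff-entry of `unitS` is a site-independent scalar multiple).
What is NOT here: the (V-H) border's fm∕mf entries on two constants (§7.2: NOT zero — the multiplier vector `q = Q″[c,c′]`), level `m ≥ 1`
(`e3Of`, invitation «W3-S3C*»), any shape∕rate of Bałaban's tables, anything of (hW, hWall).
HONEST FRAMING (cell contract, verbatim): «discharging `BetaPertH` makes Bałaban's UV stability UNCONDITIONAL — a real constructive-QFT result; it is NOT the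
continuum limit and NOT the Clay problem.»  HONEST DEPENDENCY (verbatim): «continuum YM on T⁴ ⇐ BetaPertH ∧ nine spine estimates (0/9 proved); BetaPertH ⇐ (D1) ∧
(D4) ∧ CAP+tail; G-an2-4 gates asym, D1 and NE2/3/4.»  [folklore] finite algebra; no cited fact, no `def`, no `def … : Prop`; generic `d`.  NOT summit progress.
Unit `b2b-balaban-gan24-formalise-leaf-19` (gen 18; INTENT CLAIMS.log l.7528), 2026-08-20.
-/

noncomputable section

open Finset
open scoped BigOperators
open Literature.MathematicalPhysics.QuantumFieldTheory.Balaban1983to89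
open Literature.MathematicalPhysics.QuantumFieldTheory.Balaban1983to89.Beta
open PlaquetteStencilData (WilsonIdx wα wβ wm isOffset_wα isOffset_wβ)
open StepJetData (wEntry wilsonA mfNeg mfNeg_inl_inl)
open AveragingHessianKernels (vhS packVH_inl_inl)
open BalabanStepJets (box1 mem_box1)
open BalabanStepW2 (Spure Spure_zero)
open OneStepResolventKernel (Fib)
open Summit.QuantumFields.BalabanUV.Beta.HessKerDressedUnits (unitS unitS_apply legScale_inl)
open Summit.QuantumFields.BalabanUV.Beta.GAN24.WilsonVertexSumZero (uv wc wEntry_eq_sum sum_wc_eq_zero suppW row_mem_suppW col_mem_suppW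
  wilsonA_eq_zero_left wilsonA_eq_zero_right mem_box1_of_isOffset suppW_subset_box wilsonA_tsum_zero)

namespace Summit.QuantumFields.BalabanUV.Beta.GAN24.WilsonVertexTwoConst

variable {d : ℕ}

/-! ## §1 Support in the table site -/

/-- [folklore] if the leg site `y` meets the support of the table at bond `(κ′, u)`, then `u ∈ y − {−1,0,1}^{d+1}`. -/
theorem mem_image_sub_of_mem_suppW (κ' : Fin (d + 1)) {u y : Fin (d + 1) → ℤ} (h : y ∈ suppW κ' u) :
    u ∈ (box1 (d + 1)).image fun v => y - v := by
  obtain ⟨v, hv, rfl⟩ := Finset.mem_image.1 (suppW_subset_box κ' u h)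
  exact Finset.mem_image.2 ⟨v, hv, by abel⟩

/-- [folklore] the row offsets, read backwards from a leg site, stay in `y − {−1,0,1}^{d+1}`. -/
theorem sub_wα_mem_image (κ' : Fin (d + 1)) (y : Fin (d + 1) → ℤ) (i : WilsonIdx (Fin (d + 1))) :
    y - wα uv κ' i ∈ (box1 (d + 1)).image fun v => y - v :=
  Finset.mem_image_of_mem _ (mem_box1_of_isOffset (isOffset_wα uv κ' i))

/-- [folklore] the column offsets, read backwards from a leg site, stay in `y − {−1,0,1}^{d+1}`. -/
theorem sub_wβ_mem_image (κ' : Fin (d + 1)) (y : Fin (d + 1) → ℤ) (i : WilsonIdx (Fin (d + 1))) :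
    y - wβ uv κ' i ∈ (box1 (d + 1)).image fun v => y - v :=
  Finset.mem_image_of_mem _ (mem_box1_of_isOffset (isOffset_wβ uv κ' i))

/-- [folklore] **TABLE-SITE SUPPORT, SECOND LEG FIXED**: if `u ∉ y − {−1,0,1}^{d+1}` then `wilsonA d κ′ u w y (inl α) (inl β) = 0` for every `w`. -/
theorem wilsonA_eq_zero_of_table_right (κ' : Fin (d + 1)) {u : Fin (d + 1) → ℤ} (w : Fin (d + 1) → ℤ) {y : Fin (d + 1) → ℤ}
    (hu : u ∉ (box1 (d + 1)).image fun v => y - v) (α β : Fin (d + 1)) : wilsonA d κ' u w y (Sum.inl α) (Sum.inl β) = 0 :=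
  wilsonA_eq_zero_right κ' u w (fun h => hu (mem_image_sub_of_mem_suppW κ' h)) α β

/-- [folklore] **TABLE-SITE SUPPORT, FIRST LEG FIXED**: if `u ∉ w − {−1,0,1}^{d+1}` then `wilsonA d κ′ u w y (inl α) (inl β) = 0` for every `y`. -/
theorem wilsonA_eq_zero_of_table_left (κ' : Fin (d + 1)) {u w : Fin (d + 1) → ℤ} (hu : u ∉ (box1 (d + 1)).image fun v => w - v)
    (y : Fin (d + 1) → ℤ) (α β : Fin (d + 1)) : wilsonA d κ' u w y (Sum.inl α) (Sum.inl β) = 0 :=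
  wilsonA_eq_zero_left κ' u (fun h => hu (mem_image_sub_of_mem_suppW κ' h)) y α β

/-- [folklore] JOINT SUPPORT, second leg fixed: a nonzero entry forces `u ∈ y − box` and `w ∈ suppW κ′ u`, hence
`w ∈ ⋃_{u ∈ y − box} suppW κ′ u`. -/
theorem mem_biUnion_of_wilsonA_ne_zero_left (κ' : Fin (d + 1)) {u w y : Fin (d + 1) → ℤ} {α β : Fin (d + 1)}
    (h : wilsonA d κ' u w y (Sum.inl α) (Sum.inl β) ≠ 0) :
    u ∈ (box1 (d + 1)).image (fun v => y - v) ∧ w ∈ ((box1 (d + 1)).image fun v => y - v).biUnion (suppW κ') := by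
  have hu : u ∈ (box1 (d + 1)).image fun v => y - v := by
    by_contra hu; exact h (wilsonA_eq_zero_of_table_right κ' w hu α β)
  have hw : w ∈ suppW κ' u := by
    by_contra hw; exact h (wilsonA_eq_zero_left κ' u hw y α β)
  exact ⟨hu, Finset.mem_biUnion.2 ⟨u, hu, hw⟩⟩

/-- [folklore] JOINT SUPPORT, first leg fixed. -/
theorem mem_biUnion_of_wilsonA_ne_zero_right (κ' : Fin (d + 1)) {u w y : Fin (d + 1) → ℤ} {α β : Fin (d + 1)}
    (h : wilsonA d κ' u w y (Sum.inl α) (Sum.inl β) ≠ 0) :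
    u ∈ (box1 (d + 1)).image (fun v => w - v) ∧ y ∈ ((box1 (d + 1)).image fun v => w - v).biUnion (suppW κ') := by
  have hu : u ∈ (box1 (d + 1)).image fun v => w - v := by
    by_contra hu; exact h (wilsonA_eq_zero_of_table_left κ' hu y α β)
  have hy : y ∈ suppW κ' u := by
    by_contra hy; exact h (wilsonA_eq_zero_right κ' u w hy α β)
  exact ⟨hu, Finset.mem_biUnion.2 ⟨u, hu, hy⟩⟩

/-! ## §2 The finite double sums over (table site, one leg) vanish -/

/-- [folklore] RAW TABLE, COLUMN SITE `z` FIXED: for every finite `U ∋ z − wβ i` (all `i`) and finite `S u ⊇ suppW κ′ u`,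
`Σ_{u∈U} Σ_{x∈S u} wEntry d κ′ u x z α β = Σ_i wc κ′ i α β = 0` (for each stencil index exactly one table site `u = z − wβ i` contributes). -/
theorem wEntry_sum_table_row_eq_zero (κ' : Fin (d + 1)) (α β : Fin (d + 1)) (z : Fin (d + 1) → ℤ) (U : Finset (Fin (d + 1) → ℤ))
    (hU : ∀ i, z - wβ uv κ' i ∈ U) (S : (Fin (d + 1) → ℤ) → Finset (Fin (d + 1) → ℤ)) (hS : ∀ u ∈ U, suppW κ' u ⊆ S u) :
    ∑ u ∈ U, ∑ x ∈ S u, wEntry d κ' u x z α β = 0 := by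
  have h1 : ∀ u x, wEntry d κ' u x z α β = ∑ i, if x = u + wα uv κ' i ∧ z = u + wβ uv κ' i then wc κ' i α β else 0 :=
    fun u x => wEntry_eq_sum κ' u x z α β
  simp_rw [h1]
  have h2 : ∀ u ∈ U, ∑ x ∈ S u, ∑ i, (if x = u + wα uv κ' i ∧ z = u + wβ uv κ' i then wc κ' i α β else 0) =
      ∑ i, ∑ x ∈ S u, (if x = u + wα uv κ' i ∧ z = u + wβ uv κ' i then wc κ' i α β else 0) := fun u _ => Finset.sum_comm
  rw [Finset.sum_congr rfl h2, Finset.sum_comm]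
  refine (Finset.sum_congr rfl fun i _ => ?_).trans (sum_wc_eq_zero κ' α β)
  rw [Finset.sum_eq_single_of_mem (z - wβ uv κ' i) (hU i)]
  · rw [Finset.sum_eq_single_of_mem (z - wβ uv κ' i + wα uv κ' i)
        (hS _ (hU i) (row_mem_suppW κ' (z - wβ uv κ' i) i))]
    · rw [if_pos ⟨rfl, (sub_add_cancel z _).symm⟩]
    · intro x _ hx
      split_ifs with h
      · exact absurd h.1 hx
      · rfl
  · intro u _ hu
    refine Finset.sum_eq_zero fun x _ => ?_
    split_ifs with h
    · exact absurd (eq_sub_of_add_eq h.2.symm) hu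
    · rfl

/-- [folklore] RAW TABLE, ROW SITE `x` FIXED: for every finite `U ∋ x − wα i` (all `i`) and finite `S u ⊇ suppW κ′ u`,
`Σ_{u∈U} Σ_{z∈S u} wEntry d κ′ u x z α β = 0`. -/
theorem wEntry_sum_table_col_eq_zero (κ' : Fin (d + 1)) (α β : Fin (d + 1)) (x : Fin (d + 1) → ℤ) (U : Finset (Fin (d + 1) → ℤ))
    (hU : ∀ i, x - wα uv κ' i ∈ U) (S : (Fin (d + 1) → ℤ) → Finset (Fin (d + 1) → ℤ)) (hS : ∀ u ∈ U, suppW κ' u ⊆ S u) :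
    ∑ u ∈ U, ∑ z ∈ S u, wEntry d κ' u x z α β = 0 := by
  have h1 : ∀ u z, wEntry d κ' u x z α β = ∑ i, if x = u + wα uv κ' i ∧ z = u + wβ uv κ' i then wc κ' i α β else 0 :=
    fun u z => wEntry_eq_sum κ' u x z α β
  simp_rw [h1]
  have h2 : ∀ u ∈ U, ∑ z ∈ S u, ∑ i, (if x = u + wα uv κ' i ∧ z = u + wβ uv κ' i then wc κ' i α β else 0) =
      ∑ i, ∑ z ∈ S u, (if x = u + wα uv κ' i ∧ z = u + wβ uv κ' i then wc κ' i α β else 0) := fun u _ => Finset.sum_comm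
  rw [Finset.sum_congr rfl h2, Finset.sum_comm]
  refine (Finset.sum_congr rfl fun i _ => ?_).trans (sum_wc_eq_zero κ' α β)
  rw [Finset.sum_eq_single_of_mem (x - wα uv κ' i) (hU i)]
  · rw [Finset.sum_eq_single_of_mem (x - wα uv κ' i + wβ uv κ' i)
        (hS _ (hU i) (col_mem_suppW κ' (x - wα uv κ' i) i))]
    · rw [if_pos ⟨(sub_add_cancel x _).symm, rfl⟩]
    · intro z _ hz
      split_ifs with h
      · exact absurd h.2 hz
      · rfl
  · intro u _ hu
    refine Finset.sum_eq_zero fun z _ => ?_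
    split_ifs with h
    · exact absurd (eq_sub_of_add_eq h.1.symm) hu
    · rfl

/-- [folklore] **(S3c)₀, TABLE SITE + FIRST LEG SUMMED, SECOND LEG `(y, β)` FREE**: for every finite `U ⊇ y − {−1,0,1}^{d+1}` and
finite `S u ⊇ suppW κ′ u`, `Σ_{u∈U} Σ_{w∈S u} wilsonA d κ′ u w y (inl α) (inl β) = 0`. -/
theorem wilsonA_sum_table_left_eq_zero (κ' : Fin (d + 1)) (α β : Fin (d + 1)) (y : Fin (d + 1) → ℤ) (U : Finset (Fin (d + 1) → ℤ))
    (hU : (box1 (d + 1)).image (fun v => y - v) ⊆ U) (S : (Fin (d + 1) → ℤ) → Finset (Fin (d + 1) → ℤ))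
    (hS : ∀ u ∈ U, suppW κ' u ⊆ S u) : ∑ u ∈ U, ∑ w ∈ S u, wilsonA d κ' u w y (Sum.inl α) (Sum.inl β) = 0 := by
  have h1 : ∀ u w, wilsonA d κ' u w y (Sum.inl α) (Sum.inl β) = 1 / 2 * wEntry d κ' u w y α β - 1 / 2 * wEntry d κ' u y w β α :=
    fun u w => by show 1 / 2 * (wEntry d κ' u w y α β - wEntry d κ' u y w β α) = _; ring
  simp_rw [h1, Finset.sum_sub_distrib, ← Finset.mul_sum]
  rw [wEntry_sum_table_row_eq_zero κ' α β y U (fun i => hU (sub_wβ_mem_image κ' y i)) S hS,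
    wEntry_sum_table_col_eq_zero κ' β α y U (fun i => hU (sub_wα_mem_image κ' y i)) S hS]
  ring

/-- [folklore] **(S3c)₀, TABLE SITE + SECOND LEG SUMMED, FIRST LEG `(w, α)` FREE**: for every finite `U ⊇ w − {−1,0,1}^{d+1}` and
finite `S u ⊇ suppW κ′ u`, `Σ_{u∈U} Σ_{y∈S u} wilsonA d κ′ u w y (inl α) (inl β) = 0`. -/
theorem wilsonA_sum_table_right_eq_zero (κ' : Fin (d + 1)) (α β : Fin (d + 1)) (w : Fin (d + 1) → ℤ) (U : Finset (Fin (d + 1) → ℤ))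
    (hU : (box1 (d + 1)).image (fun v => w - v) ⊆ U) (S : (Fin (d + 1) → ℤ) → Finset (Fin (d + 1) → ℤ))
    (hS : ∀ u ∈ U, suppW κ' u ⊆ S u) : ∑ u ∈ U, ∑ y ∈ S u, wilsonA d κ' u w y (Sum.inl α) (Sum.inl β) = 0 := by
  have h1 : ∀ u y, wilsonA d κ' u w y (Sum.inl α) (Sum.inl β) = 1 / 2 * wEntry d κ' u w y α β - 1 / 2 * wEntry d κ' u y w β α :=
    fun u y => by show 1 / 2 * (wEntry d κ' u w y α β - wEntry d κ' u y w β α) = _; ring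
  simp_rw [h1, Finset.sum_sub_distrib, ← Finset.mul_sum]
  rw [wEntry_sum_table_col_eq_zero κ' α β w U (fun i => hU (sub_wα_mem_image κ' w i)) S hS,
    wEntry_sum_table_row_eq_zero κ' β α w U (fun i => hU (sub_wβ_mem_image κ' w i)) S hS]
  ring

/-- [folklore] BOX FORM, second leg free: `U = y − box`, `S u = suppW κ′ u`. -/
theorem wilsonA_sum_table_left_eq_zero_box (κ' : Fin (d + 1)) (α β : Fin (d + 1)) (y : Fin (d + 1) → ℤ) :
    ∑ u ∈ (box1 (d + 1)).image (fun v => y - v), ∑ w ∈ suppW κ' u, wilsonA d κ' u w y (Sum.inl α) (Sum.inl β) = 0 :=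
  wilsonA_sum_table_left_eq_zero κ' α β y _ le_rfl _ fun _ _ => le_rfl

/-- [folklore] BOX FORM, first leg free. -/
theorem wilsonA_sum_table_right_eq_zero_box (κ' : Fin (d + 1)) (α β : Fin (d + 1)) (w : Fin (d + 1) → ℤ) :
    ∑ u ∈ (box1 (d + 1)).image (fun v => w - v), ∑ y ∈ suppW κ' u, wilsonA d κ' u w y (Sum.inl α) (Sum.inl β) = 0 :=
  wilsonA_sum_table_right_eq_zero κ' α β w _ le_rfl _ fun _ _ => le_rfl

/-! ## §3 Support-free currencies: iterated `tsum` in both orders and `HasSum` on the pair type -/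

/-- [folklore] **(S3c)₀, `tsum` FORM, second leg free**: `∑' u, ∑' w, wilsonA d κ′ u w y (inl α) (inl β) = 0`. -/
theorem wilsonA_tsum_table_left_eq_zero (κ' : Fin (d + 1)) (α β : Fin (d + 1)) (y : Fin (d + 1) → ℤ) :
    ∑' u, ∑' w, wilsonA d κ' u w y (Sum.inl α) (Sum.inl β) = 0 := by
  have hin : ∀ u, ∑' w, wilsonA d κ' u w y (Sum.inl α) (Sum.inl β) = ∑ w ∈ suppW κ' u, wilsonA d κ' u w y (Sum.inl α) (Sum.inl β) :=
    fun u => tsum_eq_sum fun w hw => wilsonA_eq_zero_left κ' u hw y α β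
  simp_rw [hin]
  rw [tsum_eq_sum (s := (box1 (d + 1)).image fun v => y - v) fun u hu =>
    Finset.sum_eq_zero fun w _ => wilsonA_eq_zero_of_table_right κ' w hu α β]
  exact wilsonA_sum_table_left_eq_zero_box κ' α β y

/-- [folklore] **(S3c)₀, `tsum` FORM, first leg free**: `∑' u, ∑' y, wilsonA d κ′ u w y (inl α) (inl β) = 0`. -/
theorem wilsonA_tsum_table_right_eq_zero (κ' : Fin (d + 1)) (α β : Fin (d + 1)) (w : Fin (d + 1) → ℤ) :
    ∑' u, ∑' y, wilsonA d κ' u w y (Sum.inl α) (Sum.inl β) = 0 := by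
  have hin : ∀ u, ∑' y, wilsonA d κ' u w y (Sum.inl α) (Sum.inl β) = ∑ y ∈ suppW κ' u, wilsonA d κ' u w y (Sum.inl α) (Sum.inl β) :=
    fun u => tsum_eq_sum fun y hy => wilsonA_eq_zero_right κ' u w hy α β
  simp_rw [hin]
  rw [tsum_eq_sum (s := (box1 (d + 1)).image fun v => w - v) fun u hu =>
    Finset.sum_eq_zero fun y _ => wilsonA_eq_zero_of_table_left κ' hu y α β]
  exact wilsonA_sum_table_right_eq_zero_box κ' α β w

/-- [folklore] `tsum` FORM IN THE OTHER ORDER, second leg free: `∑' w, ∑' u, wilsonA d κ′ u w y (inl α) (inl β) = 0`. -/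
theorem wilsonA_tsum_table_left_eq_zero' (κ' : Fin (d + 1)) (α β : Fin (d + 1)) (y : Fin (d + 1) → ℤ) :
    ∑' w, ∑' u, wilsonA d κ' u w y (Sum.inl α) (Sum.inl β) = 0 := by
  set U := (box1 (d + 1)).image fun v => y - v with hUdef
  have hin : ∀ w, ∑' u, wilsonA d κ' u w y (Sum.inl α) (Sum.inl β) = ∑ u ∈ U, wilsonA d κ' u w y (Sum.inl α) (Sum.inl β) :=
    fun w => tsum_eq_sum fun u hu => wilsonA_eq_zero_of_table_right κ' w hu α β
  simp_rw [hin]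
  rw [tsum_eq_sum (s := U.biUnion (suppW κ')) fun w hw => Finset.sum_eq_zero fun u hu =>
    wilsonA_eq_zero_left κ' u (fun h => hw (Finset.mem_biUnion.2 ⟨u, hu, h⟩)) y α β, Finset.sum_comm]
  exact wilsonA_sum_table_left_eq_zero κ' α β y U le_rfl _ fun u hu => Finset.subset_biUnion_of_mem (suppW κ') hu

/-- [folklore] `tsum` FORM IN THE OTHER ORDER, first leg free: `∑' y, ∑' u, wilsonA d κ′ u w y (inl α) (inl β) = 0`. -/
theorem wilsonA_tsum_table_right_eq_zero' (κ' : Fin (d + 1)) (α β : Fin (d + 1)) (w : Fin (d + 1) → ℤ) :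
    ∑' y, ∑' u, wilsonA d κ' u w y (Sum.inl α) (Sum.inl β) = 0 := by
  set U := (box1 (d + 1)).image fun v => w - v with hUdef
  have hin : ∀ y, ∑' u, wilsonA d κ' u w y (Sum.inl α) (Sum.inl β) = ∑ u ∈ U, wilsonA d κ' u w y (Sum.inl α) (Sum.inl β) :=
    fun y => tsum_eq_sum fun u hu => wilsonA_eq_zero_of_table_left κ' hu y α β
  simp_rw [hin]
  rw [tsum_eq_sum (s := U.biUnion (suppW κ')) fun y hy => Finset.sum_eq_zero fun u hu =>
    wilsonA_eq_zero_right κ' u w (fun h => hy (Finset.mem_biUnion.2 ⟨u, hu, h⟩)) α β, Finset.sum_comm]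
  exact wilsonA_sum_table_right_eq_zero κ' α β w U le_rfl _ fun u hu => Finset.subset_biUnion_of_mem (suppW κ') hu

/-- [folklore] **(S3c)₀, `HasSum` FORM ON THE PAIR TYPE, second leg free**: the family `(u, w) ↦ wilsonA d κ′ u w y (inl α) (inl β)` is
finitely supported and sums to `0` (order-free statement; both iterated forms above follow). -/
theorem hasSum_wilsonA_table_left (κ' : Fin (d + 1)) (α β : Fin (d + 1)) (y : Fin (d + 1) → ℤ) :
    HasSum (fun p : (Fin (d + 1) → ℤ) × (Fin (d + 1) → ℤ) => wilsonA d κ' p.1 p.2 y (Sum.inl α) (Sum.inl β)) 0 := by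
  set U := (box1 (d + 1)).image fun v => y - v with hUdef
  have hz : ∀ p ∉ U ×ˢ U.biUnion (suppW κ'), wilsonA d κ' p.1 p.2 y (Sum.inl α) (Sum.inl β) = 0 := by
    intro p hp
    by_contra h
    exact hp (Finset.mem_product.2 (mem_biUnion_of_wilsonA_ne_zero_left κ' h))
  have hsum : ∑ p ∈ U ×ˢ U.biUnion (suppW κ'), wilsonA d κ' p.1 p.2 y (Sum.inl α) (Sum.inl β) = 0 := by
    rw [Finset.sum_product]
    exact wilsonA_sum_table_left_eq_zero κ' α β y U le_rfl _ fun u hu => Finset.subset_biUnion_of_mem (suppW κ') hu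
  rw [← hsum]
  exact hasSum_sum_of_ne_finset_zero hz

/-- [folklore] **(S3c)₀, `HasSum` FORM ON THE PAIR TYPE, first leg free**. -/
theorem hasSum_wilsonA_table_right (κ' : Fin (d + 1)) (α β : Fin (d + 1)) (w : Fin (d + 1) → ℤ) :
    HasSum (fun p : (Fin (d + 1) → ℤ) × (Fin (d + 1) → ℤ) => wilsonA d κ' p.1 w p.2 (Sum.inl α) (Sum.inl β)) 0 := by
  set U := (box1 (d + 1)).image fun v => w - v with hUdef
  have hz : ∀ p ∉ U ×ˢ U.biUnion (suppW κ'), wilsonA d κ' p.1 w p.2 (Sum.inl α) (Sum.inl β) = 0 := by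
    intro p hp
    by_contra h
    exact hp (Finset.mem_product.2 (mem_biUnion_of_wilsonA_ne_zero_right κ' h))
  have hsum : ∑ p ∈ U ×ˢ U.biUnion (suppW κ'), wilsonA d κ' p.1 w p.2 (Sum.inl α) (Sum.inl β) = 0 := by
    rw [Finset.sum_product]
    exact wilsonA_sum_table_right_eq_zero κ' α β w U le_rfl _ fun u hu => Finset.subset_biUnion_of_mem (suppW κ') hu
  rw [← hsum]
  exact hasSum_sum_of_ne_finset_zero hz

/-- [folklore] W1 in the same `HasSum` currency (both kernel legs summed, table bond fixed) — from leaf-15's finite-support facts. -/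
theorem hasSum_wilsonA_legs (κ' : Fin (d + 1)) (u : Fin (d + 1) → ℤ) (α β : Fin (d + 1)) :
    HasSum (fun p : (Fin (d + 1) → ℤ) × (Fin (d + 1) → ℤ) => wilsonA d κ' u p.1 p.2 (Sum.inl α) (Sum.inl β)) 0 := by
  have hz : ∀ p ∉ suppW κ' u ×ˢ suppW κ' u, wilsonA d κ' u p.1 p.2 (Sum.inl α) (Sum.inl β) = 0 := by
    intro p hp
    rw [Finset.mem_product, not_and_or] at hp
    rcases hp with h | h
    · exact wilsonA_eq_zero_left κ' u h p.2 α β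
    · exact wilsonA_eq_zero_right κ' u p.1 h α β
  have hsum : ∑ p ∈ suppW κ' u ×ˢ suppW κ' u, wilsonA d κ' u p.1 p.2 (Sum.inl α) (Sum.inl β) = 0 := by
    rw [Finset.sum_product]
    exact WilsonVertexSumZero.wilsonA_sum_zero_of_supp κ' u α β _ le_rfl
  rw [← hsum]
  exact hasSum_sum_of_ne_finset_zero hz

/-! ## §4 The first field table of an2's step operator at level `0` and its normalised form -/

section StepZero

variable {Lc : ℕ} [NeZero Lc]

/-- [folklore] the ff-ENTRY of `Spure … 0`: the (V-H) border `mfNeg ∘ vhS` is off the field–field block (`packVH_inl_inl`), so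
`Spure d Lc cE cVH cΛ 0 κ′ u w y (inl α) (inl β) = cE · wilsonA d κ′ u w y (inl α) (inl β)`. -/
theorem Spure_zero_inl_inl (cE cVH cΛ : ℝ) (κ' : Fin (d + 1)) (u w y : Fin (d + 1) → ℤ) (α β : Fin (d + 1)) :
    Spure d Lc cE cVH cΛ 0 κ' u w y (Sum.inl α) (Sum.inl β) = cE * wilsonA d κ' u w y (Sum.inl α) (Sum.inl β) := by
  rw [Spure_zero]
  show cE * wilsonA d κ' u w y (Sum.inl α) (Sum.inl β) + cVH * mfNeg (vhS d Lc κ' u) w y (Sum.inl α) (Sum.inl β) = _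
  rw [mfNeg_inl_inl]
  show cE * wilsonA d κ' u w y (Sum.inl α) (Sum.inl β) + cVH * 0 = _
  ring

/-- [folklore] the ff-ENTRY of a NORMALISED stencil table is the site-independent multiple `(s_f s_m)⁻¹ s_f⁻²` of the raw entry. -/
theorem unitS_inl_inl (sf sm : ℝ) (S : Fin (d + 1) → (Fin (d + 1) → ℤ) → ExpKernelCalculus.MKer (d + 1) (Fib d)) (κ' : Fin (d + 1))
    (u w y : Fin (d + 1) → ℤ) (α β : Fin (d + 1)) :
    unitS sf sm S κ' u w y (Sum.inl α) (Sum.inl β) = (sf * sm)⁻¹ * (sf⁻¹ * sf⁻¹) * S κ' u w y (Sum.inl α) (Sum.inl β) := by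
  rw [unitS_apply, legScale_inl, legScale_inl]
  ring

/-- [folklore] the ff-ENTRY of the census object `S̃₀ = unitS s_f s_m (Spure … 0)`: a site-independent multiple of the `wilsonA` entry. -/
theorem unitS_Spure_zero_inl_inl (sf sm cE cVH cΛ : ℝ) (κ' : Fin (d + 1)) (u w y : Fin (d + 1) → ℤ) (α β : Fin (d + 1)) :
    unitS sf sm (Spure d Lc cE cVH cΛ 0) κ' u w y (Sum.inl α) (Sum.inl β) =
      (sf * sm)⁻¹ * (sf⁻¹ * sf⁻¹) * cE * wilsonA d κ' u w y (Sum.inl α) (Sum.inl β) := by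
  rw [unitS_inl_inl, Spure_zero_inl_inl]
  ring

/-- [folklore] **(S3c)₀ FOR `S̃₀`, KERNEL LEGS SUMMED** (table bond fixed): `∑' w, ∑' y, S̃₀ κ′ u w y (inl α) (inl β) = 0` (W1 BY NAME). -/
theorem unitS_Spure_zero_tsum_legs (sf sm cE cVH cΛ : ℝ) (κ' : Fin (d + 1)) (u : Fin (d + 1) → ℤ) (α β : Fin (d + 1)) :
    ∑' w, ∑' y, unitS sf sm (Spure d Lc cE cVH cΛ 0) κ' u w y (Sum.inl α) (Sum.inl β) = 0 := by
  simp_rw [unitS_Spure_zero_inl_inl, tsum_mul_left]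
  rw [wilsonA_tsum_zero, mul_zero]

/-- [folklore] **(S3c)₀ FOR `S̃₀`, TABLE SITE + FIRST LEG SUMMED** (second leg free): `∑' u, ∑' w, S̃₀ κ′ u w y (inl α) (inl β) = 0`. -/
theorem unitS_Spure_zero_tsum_table_left (sf sm cE cVH cΛ : ℝ) (κ' : Fin (d + 1)) (α β : Fin (d + 1)) (y : Fin (d + 1) → ℤ) :
    ∑' u, ∑' w, unitS sf sm (Spure d Lc cE cVH cΛ 0) κ' u w y (Sum.inl α) (Sum.inl β) = 0 := by
  simp_rw [unitS_Spure_zero_inl_inl, tsum_mul_left]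
  rw [wilsonA_tsum_table_left_eq_zero, mul_zero]

/-- [folklore] **(S3c)₀ FOR `S̃₀`, TABLE SITE + SECOND LEG SUMMED** (first leg free): `∑' u, ∑' y, S̃₀ κ′ u w y (inl α) (inl β) = 0`. -/
theorem unitS_Spure_zero_tsum_table_right (sf sm cE cVH cΛ : ℝ) (κ' : Fin (d + 1)) (α β : Fin (d + 1)) (w : Fin (d + 1) → ℤ) :
    ∑' u, ∑' y, unitS sf sm (Spure d Lc cE cVH cΛ 0) κ' u w y (Sum.inl α) (Sum.inl β) = 0 := by
  simp_rw [unitS_Spure_zero_inl_inl, tsum_mul_left]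
  rw [wilsonA_tsum_table_right_eq_zero, mul_zero]

/-- [folklore] the same three for the RAW level-`0` table `Spure … 0` (units `s_f = s_m = 1` not needed: direct). -/
theorem Spure_zero_tsum_legs (cE cVH cΛ : ℝ) (κ' : Fin (d + 1)) (u : Fin (d + 1) → ℤ) (α β : Fin (d + 1)) :
    ∑' w, ∑' y, Spure d Lc cE cVH cΛ 0 κ' u w y (Sum.inl α) (Sum.inl β) = 0 := by
  simp_rw [Spure_zero_inl_inl, tsum_mul_left]
  rw [wilsonA_tsum_zero, mul_zero]

/-- [folklore] raw level-`0` table, table site + first leg summed. -/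
theorem Spure_zero_tsum_table_left (cE cVH cΛ : ℝ) (κ' : Fin (d + 1)) (α β : Fin (d + 1)) (y : Fin (d + 1) → ℤ) :
    ∑' u, ∑' w, Spure d Lc cE cVH cΛ 0 κ' u w y (Sum.inl α) (Sum.inl β) = 0 := by
  simp_rw [Spure_zero_inl_inl, tsum_mul_left]
  rw [wilsonA_tsum_table_left_eq_zero, mul_zero]

/-- [folklore] raw level-`0` table, table site + second leg summed. -/
theorem Spure_zero_tsum_table_right (cE cVH cΛ : ℝ) (κ' : Fin (d + 1)) (α β : Fin (d + 1)) (w : Fin (d + 1) → ℤ) :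
    ∑' u, ∑' y, Spure d Lc cE cVH cΛ 0 κ' u w y (Sum.inl α) (Sum.inl β) = 0 := by
  simp_rw [Spure_zero_inl_inl, tsum_mul_left]
  rw [wilsonA_tsum_table_right_eq_zero, mul_zero]

/-- [folklore] **(S3c)₀ FOR `S̃₀`, `HasSum` CURRENCY** — all three pairs at once: kernel legs (table bond fixed), table site + first
leg (second leg free), table site + second leg (first leg free). -/
theorem hasSum_unitS_Spure_zero (sf sm cE cVH cΛ : ℝ) (κ' : Fin (d + 1)) (α β : Fin (d + 1)) (s : Fin (d + 1) → ℤ) :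
    HasSum (fun p : (Fin (d + 1) → ℤ) × (Fin (d + 1) → ℤ) =>
        unitS sf sm (Spure d Lc cE cVH cΛ 0) κ' s p.1 p.2 (Sum.inl α) (Sum.inl β)) 0 ∧
      HasSum (fun p : (Fin (d + 1) → ℤ) × (Fin (d + 1) → ℤ) =>
        unitS sf sm (Spure d Lc cE cVH cΛ 0) κ' p.1 p.2 s (Sum.inl α) (Sum.inl β)) 0 ∧
      HasSum (fun p : (Fin (d + 1) → ℤ) × (Fin (d + 1) → ℤ) =>
        unitS sf sm (Spure d Lc cE cVH cΛ 0) κ' p.1 s p.2 (Sum.inl α) (Sum.inl β)) 0 := by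
  simp_rw [unitS_Spure_zero_inl_inl]
  refine ⟨?_, ?_, ?_⟩
  · simpa using (hasSum_wilsonA_legs κ' s α β).mul_left ((sf * sm)⁻¹ * (sf⁻¹ * sf⁻¹) * cE)
  · simpa using (hasSum_wilsonA_table_left κ' α β s).mul_left ((sf * sm)⁻¹ * (sf⁻¹ * sf⁻¹) * cE)
  · simpa using (hasSum_wilsonA_table_right κ' α β s).mul_left ((sf * sm)⁻¹ * (sf⁻¹ * sf⁻¹) * cE)

end StepZero

end Summit.QuantumFields.BalabanUV.Beta.GAN24.WilsonVertexTwoConst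

end
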